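import Summits.QuantumFields.YangMills.Theorems.FemtoTransferGapSlab
import Summits.QuantumFields.YangMills.Theorems.FemtoTransferGapSlabGround
import Summits.QuantumFields.YangMills.Theorems.FemtoTransferGapSlabFlowLift
import Summits.QuantumFields.YangMills.Theorems.FemtoTransferGapSlabRayleigh
import Summits.QuantumFields.YangMills.Theorems.FemtoTransferGapLevels
import Summits.QuantumFields.YangMills.Theorems.FemtoTransferGapBounds
import Summits.QuantumFields.YangMills.Theorems.FemtoTransferGapReduction
import Summits.QuantumFields.YangMills.Theorems.LuscherReductionOneSiteLevelsIMS
import Summits.QuantumFields.YangMills.Theorems.LuscherReductionOneSiteLevelsVariational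

/-!
# Crux RED `RunningReduction` (stmt-QuantumFields-19978) — count-neutral SUPPORT for KTR rev 3 stub #5 `stub_explicitNoIntruder`

Planner ym-cruxidea-19978-2 GEN 5 (crux-ideate, cards `vacuum-chain-transit` rev 3 / `handover-split` rev 5), 2026-08-27.
Sorry-free bookkeeping around the owner's (ym-beyond-p1 g17) typed Option I statement `KT.ExplicitNoIntruder`
(`p1-g17-files/Lines-KTR-r3.lean` sha16 04b54eb2275f0fa2 §8; `HandoverAudit-g17.lean` §4), proved over TREE declarations only:

* §1 verbatim compat copies of `KT.dressedLift` / `KT.ExplicitNoIntruder` (the owner's module is not importable until the operator mirrors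
  `Cruxes/RunningReduction/Lines/ktr.lean`; the copies are syntactically identical, so every theorem below retargets by `Iff.rfl`).
* §2 `isPhys_dressedLift`: the `IsPhys` conjunct of the stub is DISCHARGED for every physical one-site function `u` (tree `isPhys_flowLift`,
  `isPhys_slabGround`, `IsPhys.mul_of_invariant`) — the conjunct is pure bookkeeping once the `u_i` are physical one-site functions; the XL content
  of the stub is the long-time bound alone.
* §3 `moment_le_pow`: `⟨ψ, K_β^n ψ⟩ ≤ λ₀^n ‖ψ‖²` for every physical `ψ`, every `n`, `β ≥ 0` — WITHOUT a spectral theorem (slab growth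
  `‖Φ_j‖² ≤ λ₀^{2j}` + domination `‖K^jψ‖² ≤ c²‖Φ_j‖²` + the dyadic Cauchy–Schwarz chain), and from it the degenerate instance
  `explicitNoIntruder_zero : ExplicitNoIntruder 0` (the owner's §5 «k = 0 consistent, not vacuous» made kernel-checked).
* §4 `explicitNoIntruder_of_le`: padding the constraint list — `ExplicitNoIntruder k₀ → ExplicitNoIntruder k` whenever `k₀ ≤ k` and
  `Δ_k ≤ Δ_{k₀}`; so inside a degenerate one-site multiplet the instance at the multiplet BOTTOM implies all the others, and `∀ k` reduces to the
  multiplet bottoms (card `gap-atom-multiplet` F1: the route's `closes` consumes `k = 1` only — cf. owner's `femtoGapSU2_of_explicit`).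

HONEST FRAMING: fixed-lattice bookkeeping; nothing here touches the XL content (asymptotic freedom / effective toron dynamics uniformly in `L`);
femto rung R2b1 only, not the Clay gap.  References: M. Reed, B. Simon IV (1978) Thm XIII.1 (min–max / Rayleigh bounds); M. Lüscher, NPB 219
(1983) 233 (femto universe); M. Lüscher, JHEP 1008:071 (2010) (gradient flow, for `flowLift`).
-/

set_option autoImplicit false

noncomputable section

namespace Summit.QuantumFields.YangMills.Cruxes.RunningReduction.ExplicitSupport

open MeasureTheory Filter Topology Real
open Literature.MathematicalPhysics.QuantumFieldTheory
open Literature.MathematicalPhysics.QuantumLattice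
open Literature.Analysis.OperatorTheory.YMMatrixModel
open Summit.QuantumFields.YangMills.Theorems.FemtoTransferGap

/-! ## §1 Compat copies (verbatim) of the owner's `KT.dressedLift` / `KT.ExplicitNoIntruder` (KTR rev 3 §8) -/

/-- The dressed flowed Polyakov lift of a one-site function `u`: `(flowLift t u) · Φ_m` with `Φ_m = K_β^m 1` the free-boundary slab (vacuum
proxy).  Verbatim copy of `KT.dressedLift` (KTR rev 3). [cite: Luscher2010, §2.1] -/
def dressedLift {L : ℕ} [NeZero L] (β t : ℝ) (m : ℕ) (u : GaugeConfig 3 1 SU2 → ℝ) : GaugeConfig 3 L SU2 → ℝ :=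
  fun U => flowLift t u U * slabGround β m U

/-- **Option I «explicit no-intruder law» at level `k`** (verbatim copy of `KT.ExplicitNoIntruder`, KTR rev 3 §8 / owner memo 3a′-g17 §2):
for every `ε > 0` there are a physical-time scale `M > 0` and thresholds such that, eventually in the femto window, `k` dressed flowed Polyakov
lifts of `k` one-site functions kill every intruder over long times `nλ/L ∈ [M, 2M]`:
`ψ ⊥ dressedLift β t m u_i (i < k)` ⇒ `⟨ψ, K^n ψ⟩ ≤ e^{−(Δ_k − ε) nλ/L} λ₀^n ‖ψ‖²`. [cite: Luscher1983, §1] -/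
def ExplicitNoIntruder (k : ℕ) : Prop :=
  ∀ ε : ℝ, 0 < ε → ∃ M : ℝ, 0 < M ∧ ∃ lam0 : ℝ, 0 < lam0 ∧ ∀ lam : ℝ, 0 < lam → lam ≤ lam0 →
    ∃ L1 : ℕ, ∀ (L : ℕ) [NeZero L], L1 ≤ L → ∀ β : ℝ, InFemtoWindow lam β L →
      ∃ (t : ℝ) (m : ℕ) (u : Fin k → (GaugeConfig 3 1 SU2 → ℝ)),
        (∀ i, IsPhys (dressedLift (L := L) β t m (u i))) ∧
        ∀ n : ℕ, M ≤ n * luscherLambda β L / L → n * luscherLambda β L / L ≤ 2 * M →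
          ∀ ψ : GaugeConfig 3 L SU2 → ℝ, IsPhys ψ → (∀ i, l2 ψ (dressedLift β t m (u i)) = 0) →
            l2 ψ ((transferApply β)^[n] ψ) ≤
              Real.exp (-((levelGap k - ε) * (n * luscherLambda β L / L))) * levelValue su2Rep L β 0 ^ n * l2 ψ ψ

section FixedLattice

variable {L : ℕ} [NeZero L]

/-! ## §2 The `IsPhys` conjunct is bookkeeping: dressed lifts of physical one-site functions are physical -/

/-- **`dressedLift β t m u` is physical for a physical one-site `u`**: the flowed Polyakov lift `flowLift t u` is measurable, bounded,
gauge- and twist-invariant (`isPhys_flowLift`), the slab `Φ_m` is physical (`isPhys_slabGround`), and a product of an invariant bounded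
measurable cut-off with a physical function is physical (`IsPhys.mul_of_invariant`). [cite: Luscher2010, §2.1] -/
theorem isPhys_dressedLift (β t : ℝ) (m : ℕ) {u : GaugeConfig 3 1 SU2 → ℝ} (hu : IsPhys u) :
    IsPhys (dressedLift (L := L) β t m u) := by
  have hJ := isPhys_flowLift (L := L) t hu
  obtain ⟨C, hC⟩ := hJ.bounded
  exact (isPhys_slabGround β m).mul_of_invariant hJ.measurable hC hJ.gaugeInv hJ.zeroFlux

/-- In particular the lift of a CONSTANT one-site function is physical (used to pad constraint lists). [folklore] -/
theorem isPhys_dressedLift_const (β t : ℝ) (m : ℕ) (c : ℝ) :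
    IsPhys (dressedLift (L := L) β t m fun _ => c) :=
  isPhys_dressedLift β t m (isPhys_const c)

/-! ## §3 Moment bound `⟨ψ, K^n ψ⟩ ≤ λ₀^n ‖ψ‖²` without a spectral theorem, and the degenerate instance `k = 0` -/

/-- **Growth of the vacuum proxies**: `‖Φ_j‖² ≤ λ₀^{2j}` for `β ≥ 0` (`⟨Φ_m, KΦ_m⟩ ≤ λ₀‖Φ_m‖²` by the Rayleigh bound, and
`‖Φ_{m+1}‖⁴ = ⟨Φ_{m+1}, KΦ_m⟩² ≤ ⟨Φ_{m+1},KΦ_{m+1}⟩⟨Φ_m,KΦ_m⟩` by Cauchy–Schwarz for the positive form). [cite: ReedSimonIV1978, Thm. XIII.1] -/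
theorem l2_slabGround_le_pow {β : ℝ} (hβ : 0 ≤ β) (j : ℕ) :
    l2 (slabGround (L := L) β j) (slabGround (L := L) β j) ≤ levelValue su2Rep L β 0 ^ (2 * j) := by
  have hphys : ∀ m, IsPhys (slabGround (L := L) β m) := fun m => isPhys_slabGround β m
  have hNpos : ∀ m, 0 < l2 (slabGround (L := L) β m) (slabGround (L := L) β m) := fun m => l2_slabGround_pos β m
  have hl0 : 0 < levelValue su2Rep L β 0 := levelValue_zero_su2Rep_pos L β
  have hNeq : ∀ m, l2 (slabGround (L := L) β (m + 1)) (slabGround (L := L) β (m + 1)) =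
      qform su2Rep β (slabGround (L := L) β (m + 1)) (slabGround (L := L) β m) := fun m => by
    have h := l2_transferApply_left β (slabGround (L := L) β m) (slabGround (L := L) β (m + 1))
    rwa [← slabGround_succ] at h
  have hQpos : ∀ m, 0 < qform su2Rep β (slabGround (L := L) β m) (slabGround (L := L) β m) := fun m => by
    have hQeq : qform su2Rep β (slabGround (L := L) β m) (slabGround (L := L) β m) =
        l2 (slabGround (L := L) β (m + 1)) (slabGround (L := L) β m) := by
      rw [slabGround_succ, l2_transferApply_left]
    obtain ⟨c, hc, hcle⟩ := exists_pos_le_slabGround (L := L) β (m + 1)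
    obtain ⟨d, hd, hdle⟩ := exists_pos_le_slabGround (L := L) β m
    rw [hQeq]
    exact l2_pos_of_le (hphys _) (hphys _) hc hd hcle hdle
  have hQN : ∀ m, qform su2Rep β (slabGround (L := L) β m) (slabGround (L := L) β m) ≤
      levelValue su2Rep L β 0 * l2 (slabGround (L := L) β m) (slabGround (L := L) β m) := fun m =>
    qform_le_levelValue_zero_mul su2Rep continuous_su2Rep β (hphys m) (hNpos m)
  have hNQ : ∀ m, l2 (slabGround (L := L) β (m + 1)) (slabGround (L := L) β (m + 1)) ≤
      levelValue su2Rep L β 0 * qform su2Rep β (slabGround (L := L) β m) (slabGround (L := L) β m) := by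
    intro m
    have h2 : l2 (slabGround (L := L) β (m + 1)) (slabGround (L := L) β (m + 1)) ^ 2 ≤
        qform su2Rep β (slabGround (L := L) β (m + 1)) (slabGround (L := L) β (m + 1)) * qform su2Rep β (slabGround (L := L) β m) (slabGround (L := L) β m) := by
      rw [hNeq]; exact sq_qform_le hβ (hphys _) (hphys _)
    have h3 : l2 (slabGround (L := L) β (m + 1)) (slabGround (L := L) β (m + 1)) * l2 (slabGround (L := L) β (m + 1)) (slabGround (L := L) β (m + 1)) ≤
        l2 (slabGround (L := L) β (m + 1)) (slabGround (L := L) β (m + 1)) *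
          (levelValue su2Rep L β 0 * qform su2Rep β (slabGround (L := L) β m) (slabGround (L := L) β m)) := by
      calc _ = l2 (slabGround (L := L) β (m + 1)) (slabGround (L := L) β (m + 1)) ^ 2 := (sq _).symm
        _ ≤ _ := h2
        _ ≤ (levelValue su2Rep L β 0 * l2 (slabGround (L := L) β (m + 1)) (slabGround (L := L) β (m + 1))) *
              qform su2Rep β (slabGround (L := L) β m) (slabGround (L := L) β m) :=
            mul_le_mul_of_nonneg_right (hQN (m + 1)) (hQpos m).le
        _ = _ := by ring
    exact le_of_mul_le_mul_left h3 (hNpos (m + 1))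
  induction j with
  | zero => simp [slabGround_zero, l2]
  | succ m ih =>
    calc l2 (slabGround (L := L) β (m + 1)) (slabGround (L := L) β (m + 1))
        ≤ levelValue su2Rep L β 0 * qform su2Rep β (slabGround (L := L) β m) (slabGround (L := L) β m) := hNQ m
      _ ≤ levelValue su2Rep L β 0 * (levelValue su2Rep L β 0 * l2 (slabGround (L := L) β m) (slabGround (L := L) β m)) :=
          mul_le_mul_of_nonneg_left (hQN m) hl0.le
      _ ≤ levelValue su2Rep L β 0 * (levelValue su2Rep L β 0 * levelValue su2Rep L β 0 ^ (2 * m)) :=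
          mul_le_mul_of_nonneg_left (mul_le_mul_of_nonneg_left ih hl0.le) hl0.le
      _ = levelValue su2Rep L β 0 ^ (2 * (m + 1)) := by ring

/-- **Moment bound without a spectral theorem**: `⟨ψ, K_β^n ψ⟩ ≤ λ₀^n ‖ψ‖²` for every physical `ψ`, every `n`, `β ≥ 0`.
Proof: `a_j := ⟨ψ,K^jψ⟩` satisfies `a_j² ≤ a_0 a_{2j}` (Cauchy–Schwarz + symmetry of `K`) and `a_{2j} = ‖K^jψ‖² ≤ c²‖Φ_j‖² ≤ c²λ₀^{2j}`
(domination by the slabs, `l2_slabGround_le_pow`); the dyadic chain `(a_n/‖ψ‖²)^{2^{q+1}} ≤ a_{n2^{q+1}}/‖ψ‖² ≤ c²λ₀^{n2^{q+1}}/‖ψ‖²` forbids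
`a_n > λ₀^n‖ψ‖²`. [cite: ReedSimonIV1978, Thm. XIII.1] -/
theorem moment_le_pow {β : ℝ} (hβ : 0 ≤ β) {ψ : GaugeConfig 3 L SU2 → ℝ} (hψ : IsPhys ψ) (n : ℕ) :
    l2 ψ ((transferApply β)^[n] ψ) ≤ levelValue su2Rep L β 0 ^ n * l2 ψ ψ := by
  have hl0 : 0 < levelValue su2Rep L β 0 := levelValue_zero_su2Rep_pos L β
  obtain ⟨c, hc⟩ := hψ.bounded
  -- Cauchy–Schwarz: `a_j² ≤ a_0 a_{2j}`
  have hCS : ∀ j, l2 ψ ((transferApply β)^[j] ψ) ^ 2 ≤ l2 ψ ψ * l2 ψ ((transferApply β)^[2 * j] ψ) := fun j => by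
    have h := sq_l2_le hψ (isPhys_iterate_transferApply β hψ j)
    rwa [l2_iterate_iterate β hψ j j, ← two_mul] at h
  -- domination + growth: `a_{2j} = ‖K^jψ‖² ≤ c² λ₀^{2j}`
  have hdom : ∀ j, l2 ψ ((transferApply β)^[2 * j] ψ) ≤ c ^ 2 * levelValue su2Rep L β 0 ^ (2 * j) := fun j => by
    have hM : l2 ψ ((transferApply β)^[2 * j] ψ) = l2 ((transferApply β)^[j] ψ) ((transferApply β)^[j] ψ) := by
      rw [l2_iterate_iterate β hψ j j, two_mul]
    rw [hM]
    exact (l2_iterate_le β hψ hc j).trans (mul_le_mul_of_nonneg_left (l2_slabGround_le_pow hβ j) (sq_nonneg c))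
  rcases (l2_self_nonneg ψ).eq_or_lt with h0 | hpos
  · -- `‖ψ‖² = 0`: then `a_n² ≤ 0`
    have h := hCS n
    rw [← h0, zero_mul] at h
    have ha : l2 ψ ((transferApply β)^[n] ψ) = 0 := pow_eq_zero_iff (two_ne_zero) |>.mp (le_antisymm h (sq_nonneg _))
    rw [ha, ← h0, mul_zero]
  · -- main case: the dyadic chain
    have hΛ : 0 < levelValue su2Rep L β 0 ^ n := pow_pos hl0 n
    rw [← div_le_iff₀ hpos]
    set r : ℝ := l2 ψ ((transferApply β)^[n] ψ) / l2 ψ ψ with hr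
    have hD : ∀ q : ℕ, r ^ (2 ^ (q + 1)) ≤ l2 ψ ((transferApply β)^[n * 2 ^ (q + 1)] ψ) / l2 ψ ψ := by
      intro q
      induction q with
      | zero =>
        have h1 := hCS n
        rw [show 2 ^ (0 + 1) = 2 by norm_num, show n * 2 = 2 * n by ring, hr, div_pow,
          div_le_div_iff₀ (pow_pos hpos 2) hpos]
        calc l2 ψ ((transferApply β)^[n] ψ) ^ 2 * l2 ψ ψ
            ≤ (l2 ψ ψ * l2 ψ ((transferApply β)^[2 * n] ψ)) * l2 ψ ψ := mul_le_mul_of_nonneg_right h1 hpos.le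
          _ = l2 ψ ((transferApply β)^[2 * n] ψ) * l2 ψ ψ ^ 2 := by ring
      | succ q ih =>
        have hnn : 0 ≤ r ^ (2 ^ (q + 1)) := Even.pow_nonneg ⟨2 ^ q, by ring⟩ r
        have h2 := hCS (n * 2 ^ (q + 1))
        rw [show 2 * (n * 2 ^ (q + 1)) = n * 2 ^ (q + 1 + 1) by ring] at h2
        calc r ^ (2 ^ (q + 1 + 1)) = (r ^ (2 ^ (q + 1))) ^ 2 := by rw [← pow_mul]; ring
          _ ≤ (l2 ψ ((transferApply β)^[n * 2 ^ (q + 1)] ψ) / l2 ψ ψ) ^ 2 := pow_le_pow_left₀ hnn ih 2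
          _ = l2 ψ ((transferApply β)^[n * 2 ^ (q + 1)] ψ) ^ 2 / l2 ψ ψ ^ 2 := div_pow _ _ 2
          _ ≤ (l2 ψ ψ * l2 ψ ((transferApply β)^[n * 2 ^ (q + 1 + 1)] ψ)) / l2 ψ ψ ^ 2 :=
              div_le_div_of_nonneg_right h2 (sq_nonneg _)
          _ = l2 ψ ((transferApply β)^[n * 2 ^ (q + 1 + 1)] ψ) / l2 ψ ψ := by
              rw [sq, mul_div_mul_left _ _ hpos.ne']
    -- combine with domination: `(r / λ₀^n)^{2^{q+1}} ≤ c² / ‖ψ‖²`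
    have hfin : ∀ q : ℕ, (r / levelValue su2Rep L β 0 ^ n) ^ (2 ^ (q + 1)) ≤ c ^ 2 / l2 ψ ψ := by
      intro q
      have hk : 0 < (levelValue su2Rep L β 0 ^ n) ^ (2 ^ (q + 1)) := pow_pos hΛ _
      have hd := hdom (n * 2 ^ q)
      rw [show 2 * (n * 2 ^ q) = n * 2 ^ (q + 1) by ring, pow_mul] at hd
      rw [div_pow, div_le_iff₀ hk]
      calc r ^ 2 ^ (q + 1) ≤ l2 ψ ((transferApply β)^[n * 2 ^ (q + 1)] ψ) / l2 ψ ψ := hD q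
        _ ≤ (c ^ 2 * (levelValue su2Rep L β 0 ^ n) ^ 2 ^ (q + 1)) / l2 ψ ψ := div_le_div_of_nonneg_right hd hpos.le
        _ = c ^ 2 / l2 ψ ψ * (levelValue su2Rep L β 0 ^ n) ^ 2 ^ (q + 1) := by ring
    by_contra hlt
    rw [not_le] at hlt
    have hgt : 1 < r / levelValue su2Rep L β 0 ^ n := by rw [lt_div_iff₀ hΛ, one_mul]; exact hlt
    obtain ⟨k₀, hk₀⟩ := Filter.eventually_atTop.1
      ((tendsto_pow_atTop_atTop_of_one_lt hgt).eventually (eventually_gt_atTop (c ^ 2 / l2 ψ ψ)))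
    have hle : k₀ ≤ 2 ^ (k₀ + 1) := (Nat.lt_two_pow_self).le.trans (Nat.pow_le_pow_right two_pos (Nat.le_succ _))
    exact absurd (hfin k₀) (not_le.mpr (hk₀ _ hle))

end FixedLattice

/-- `Δ_0 = 0`. [cite: Luscher1983, §1] -/
theorem levelGap_zero : levelGap 0 = 0 := by
  simp [levelGap]

/-- **The degenerate instance `k = 0` is a THEOREM** (no constraints; rate `Δ_0 − ε = −ε ≤ 0`): `⟨ψ,K^nψ⟩ ≤ λ₀^n‖ψ‖² ≤ e^{εnλ/L}λ₀^n‖ψ‖²`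
by `moment_le_pow` — the owner's §5 degenerate-instance pass («consistent, not vacuous») kernel-checked. [cite: ReedSimonIV1978, Thm. XIII.1] -/
theorem explicitNoIntruder_zero : ExplicitNoIntruder 0 := by
  intro ε hε
  refine ⟨1, one_pos, 1, one_pos, fun lam hlam _ => ⟨0, fun L _ _ β hW => ?_⟩⟩
  refine ⟨0, 0, fun i => Fin.elim0 i, fun i => Fin.elim0 i, fun n _ _ ψ hψ _ => ?_⟩
  have hβ : (0 : ℝ) ≤ β := zero_le_one.trans hW.1
  have hl : 0 < luscherLambda β L := luscherLambda_pos_of_window hlam hW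
  have hl0 : 0 < levelValue su2Rep L β 0 := levelValue_zero_su2Rep_pos L β
  have hτ : 0 ≤ (n : ℝ) * luscherLambda β L / L := div_nonneg (mul_nonneg (Nat.cast_nonneg n) hl.le) (Nat.cast_nonneg L)
  have hexp : 1 ≤ Real.exp (-((levelGap 0 - ε) * (n * luscherLambda β L / L))) := by
    rw [levelGap_zero]
    exact Real.one_le_exp (by nlinarith)
  calc l2 ψ ((transferApply β)^[n] ψ) ≤ levelValue su2Rep L β 0 ^ n * l2 ψ ψ := moment_le_pow hβ hψ n
    _ = 1 * (levelValue su2Rep L β 0 ^ n * l2 ψ ψ) := (one_mul _).symm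
    _ ≤ Real.exp (-((levelGap 0 - ε) * (n * luscherLambda β L / L))) * (levelValue su2Rep L β 0 ^ n * l2 ψ ψ) :=
        mul_le_mul_of_nonneg_right hexp (mul_nonneg (pow_nonneg hl0.le n) (l2_self_nonneg ψ))
    _ = _ := (mul_assoc _ _ _).symm

/-! ## §4 Padding the constraint list: `∀ k` reduces to the multiplet bottoms -/

/-- **More constraints and a smaller rate only help**: if `k₀ ≤ k` and `Δ_k ≤ Δ_{k₀}` then `ExplicitNoIntruder k₀ → ExplicitNoIntruder k`
(pad the `k₀` one-site functions with constant zeros — their lifts are physical by `isPhys_dressedLift_const` — use only the first `k₀`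
orthogonality relations, and weaken the rate).  Inside a degenerate one-site multiplet `Δ_{k₀} = ⋯ = Δ_{k₁}` the bottom instance `k₀` gives
all of them. [folklore] -/
theorem explicitNoIntruder_of_le {k₀ k : ℕ} (hk : k₀ ≤ k) (hgap : levelGap k ≤ levelGap k₀) (h : ExplicitNoIntruder k₀) :
    ExplicitNoIntruder k := by
  intro ε hε
  obtain ⟨M, hM, lam0, hlam0, hrest⟩ := h ε hε
  refine ⟨M, hM, lam0, hlam0, fun lam hlam hle => ?_⟩
  obtain ⟨L1, hL1⟩ := hrest lam hlam hle
  refine ⟨L1, fun L _ hL β hW => ?_⟩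
  obtain ⟨t, m, u, hphys, hbound⟩ := hL1 L hL β hW
  have hl : 0 < luscherLambda β L := luscherLambda_pos_of_window hlam hW
  have hl0 : 0 < levelValue su2Rep L β 0 := levelValue_zero_su2Rep_pos L β
  refine ⟨t, m, fun i => if hi : (i : ℕ) < k₀ then u ⟨i, hi⟩ else fun _ => 0, fun i => ?_, fun n hn1 hn2 ψ hψ horth => ?_⟩
  · by_cases hi : (i : ℕ) < k₀
    · simp only [dif_pos hi]; exact hphys ⟨i, hi⟩
    · simp only [dif_neg hi]; exact isPhys_dressedLift_const β t m 0
  · have horth' : ∀ j : Fin k₀, l2 ψ (dressedLift β t m (u j)) = 0 := fun j => by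
      simpa [Fin.isLt] using horth ⟨j, lt_of_lt_of_le j.isLt hk⟩
    have hb := hbound n hn1 hn2 ψ hψ horth'
    have hτ : 0 ≤ (n : ℝ) * luscherLambda β L / L := div_nonneg (mul_nonneg (Nat.cast_nonneg n) hl.le) (Nat.cast_nonneg L)
    have hexp : Real.exp (-((levelGap k₀ - ε) * (n * luscherLambda β L / L))) ≤
        Real.exp (-((levelGap k - ε) * (n * luscherLambda β L / L))) :=
      Real.exp_le_exp.mpr (by nlinarith [mul_le_mul_of_nonneg_right hgap hτ])
    exact hb.trans (mul_le_mul_of_nonneg_right (mul_le_mul_of_nonneg_right hexp (pow_nonneg hl0.le n)) (l2_self_nonneg ψ))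

/-- The `∀ k` statement (= KTR rev 3 `Stmt.stub_explicitNoIntruder`, verbatim shape) follows from its instances at the bottoms of the one-site
multiplets: it suffices to prove `ExplicitNoIntruder (b k)` for a «bottom selector» `b` with `b k ≤ k` and `Δ_k ≤ Δ_{b k}`. [folklore] -/
theorem forall_explicitNoIntruder_of_bottoms (b : ℕ → ℕ) (hb : ∀ k, b k ≤ k) (hgap : ∀ k, levelGap k ≤ levelGap (b k))
    (h : ∀ k, ExplicitNoIntruder (b k)) : ∀ k, ExplicitNoIntruder k :=
  fun k => explicitNoIntruder_of_le (hb k) (hgap k) (h k)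

end Summit.QuantumFields.YangMills.Cruxes.RunningReduction.ExplicitSupport

end
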